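import Literature.Probability.Percolation.MarkedLoopSiteLawCount
import Literature.Probability.Percolation.MarkedLoopBoundaryLawModule
import HarnessLib

/-!
# The SITE LAW for the full link-pattern law (every number of marks): `N_p(z)` and the boundary law `lawLP z` agree at the two mid-edges around one boundary hexagon («LAW-SITE-LAW»)

Topic `Literature/Probability/Percolation`; generic-`k` layer of the marked-loop (Khristoforov–Smirnov) lineage; a rider on `MarkedLoopSiteLaw.lean` (the TIP between two
`H_G`-edges `b`, `b'` around a non-marked boundary hexagon: `TipFace`; the toggle of the half-edge `b'` is a bijection `W_b(F) ≅ W_{b'}(v')` of the XOR spaces —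
`erase_mem_TXb`, `insert_mem_TXb_iff`, `side'_mem_of_mem_TXb`, `side_not_mem_of_mem_TXb'`; the strand of the odd face moves with it — `reachable_erase`, `reachable_of_erase`,
`reachable_erase_of_walk`; ★ `site_law_classCount`: the CLASS counts `N_j(z)` agree at `b` and `b'`), on `MarkedLoopSiteLawCount.lean` (the same along a stretch / a run:
`leftFace_not_mem_corners_of_mem_stretch`, `fst_iter_eq_of_between`) and on `MarkedLoopTripodBasis.lean` / `MarkedLoopBoundaryLawModule.lean` (the PATTERN counts
`patternCount D v i p = N_p(z)` — partner AND link relation — and the boundary law `lawLP z : LinkPattern (k+1) →₀ ℂ`).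

The upgrade from classes to patterns needs one more invariant of the toggle: the LINK RELATION among the corner faces. In `ξ ∈ W_b(F)` the tip `F` has valence one (its only
available side `b'` is present), so no strand between two corner faces passes through `F`, and deleting `b'` changes no link among faces other than `F`
(`reachable_erase_of_walk` both ways):

* `TipFace.reachable_erase_iff` / ★ `TipFace.linkRel_erase` — for `ξ ∈ W_b(F)`, `linkRel D (ξ ∖ {b'}) = linkRel D ξ`;
* ★★ `TipFace.card_filter_pattern_tip_eq` — the toggle is a PATTERN-preserving bijection: `#{ξ ∈ W_b(F) : F ↔ u_j, linkRel ξ = L} = #{η ∈ W_{b'}(v') : v' ↔ u_j, linkRel η = L}`;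
* ★★★ `TipFace.patternCount_eq` — **THE SITE LAW FOR `N_p`**: `patternCount D v i p = patternCount D v' i' p` for every pattern `p` (both halves of each subdivided edge, the two
  roles of `b`, `b'` exchanged as in `site_law_classCount`);
* `patternCount_oppFace_oppIdx` — `N_p` is a function of the mid-edge (either face of the edge reads the same number);
* ★★ `patternCount_site_law_darts` / `patternCount_site_law_stretch` / `patternCount_leftFace_swap` / ★★ `patternCount_site_law_run` — the dart, stretch (`k ≥ 2`) and run
  (`k ≥ 3`) forms, verbatim ports of the class-count versions of `MarkedLoopSiteLawCount.lean`: ANY two darts of one stretch with the same tail carry the same `N_p` at their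
  dual edges — **the law of the link pattern at a boundary mid-edge is a function of the boundary HEXAGON**;
* ★★★ `ArcPoint.vec_eq_of_tipFace` / `lawLP_eq_of_tipFace` — for two boundary mid-edges `z`, `z'` of an arc forming a tip, the count vectors and (home arc) the boundary
  link-pattern laws COINCIDE: `lawLP z = lawLP z'`.

Why the lane wants it (HOME `FINDING-BSPAN-SLIDE-INDUCTION.md`): it is the zeroth surgery identity of the boundary-law calculus (moving the observation point `z` along a boundary
hexagon costs nothing), it shrinks the family of lawpoints in `BSpan` / `bNonvanish_last_iff_span_lawLP` to one law per boundary SITE of the arc, and it is the pattern-level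
form of Khristoforov–Smirnov's Remark 6 («the same functions … on the vertices»).

## References
* M. Khristoforov, S. Smirnov, *Percolation and O(1) loop model*, arXiv:2111.15612 (2021), §1.2 (arXiv v1 p. 2: loop representation, half-edges, the link pattern `IP(ξ)`
  «is a union of disjoint paths, matching marked points»), §2 Definition 3 (p. 4), Remark 6 (p. 5).
* B. Bollobás, O. Riordan, *Percolation*, CUP (2006), Ch. 7 §7.2.2 (pp. 191–195): discrete domains of `𝕋`, the boundary walk and its arcs.

## Mathlib / tree
Mathlib: `SimpleGraph.Reachable.mono`, `Finset.card_bij`, `Finset.filter_congr`, `Finsupp.ext`. Tree: `MarkedLoopSiteLaw` (`TipFace`, `TipFace.symm`, `erase_mem_TXb`,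
`insert_mem_TXb_iff`, `side'_mem_of_mem_TXb`, `side_not_mem_of_mem_TXb'`, `reachable_erase`, `reachable_of_erase`, `reachable_erase_of_walk`, `TipFace.eq_or_eq_of_side_eq`,
`exists_tipFace_of_apex_not_mem`), `MarkedLoopSiteLawCount` (`leftFace_not_mem_corners_of_mem_stretch`, `fst_iter_eq_of_between`), `MarkedLoopTripodBasis` (`Pat`, `patternCount`),
`MarkedLoopBoundaryLawModule` (`lawLP`, `lawLP_apply`), `MarkedLoopBoundarySpan` (`ArcPoint`, `ArcPoint.vec`), `MarkedLoopHolomorphy` (`linkRel`, `mem_linkRel`, `yc_mem_corners`),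
`KhSThreeDisorderObservable` (`TXb`, `mem_TXb_iff`, `hbK_inClassX_iff`), `KhSThreeDisorderContour` (`loopSpaceX_comm`, `inClassX_comm`, `TXb_oppFace_oppIdx`),
`FivePointNormalisation` (`N5.sideGraph`, `xiLinked_iff_reachable`, `side_oppFace_oppIdx`), `MarkedLoopSpace` (`eq_or_eq_of_inc_three`, `mem_touching_of_side_mem`),
`TriDiscShelling` (`leftFace`, `leftFace_ne_leftFace_symm`, `triLeftApex`), `TriDiscreteDomain` (`triBdryIter`, `triBdrySucc`, `stretch`).
-/

open Finset

namespace Literature.Probability.Percolation.MarkedLoops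

open Literature.Probability.Percolation Literature.Probability.LatticeModels
open Literature.Probability.Percolation.FivePoint (side side_injective XiLinked Inc inc_side inc_mk_iff)
open Literature.Probability.Percolation.FivePoint.N5 (sideGraph side_oppFace_oppIdx xiLinked_iff_reachable)
open TriMarkedDomain

/-! ### The toggle preserves the link relation among the corners -/

section TipPattern

variable {nm : ℕ} {D : TriMarkedDomain nm} {v v' : HexVertex} {i i' : Fin 3} (T : TipFace D v i v' i')
include T

/-- a corner face is not the tip (the tip is not a corner face). [cite: KhristoforovSmirnov2021, §1.2 (arXiv v1 p. 2)] -/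
theorem TipFace.yc_ne_oppFace (j : Fin nm) : yc D j ≠ oppFace v i := fun e => T.not_corner (e ▸ yc_mem_corners D j)

omit T in
/-- the side graph is monotone under deleting an edge. [cite: KhristoforovSmirnov2021, §1.2 (arXiv v1 p. 2: the paths of `IP(ξ)`)] -/
theorem sideGraph_erase_le' (ξ : Finset (Sym2 (Site 2))) (e : Sym2 (Site 2)) : sideGraph (ξ.erase e) ≤ sideGraph ξ :=
  fun _ _ ⟨j, h1, h2⟩ => ⟨j, h1, Finset.mem_of_mem_erase h2⟩

/-- ★ **links between faces other than the tip survive the toggle, both ways**: in an edge set avoiding `b`, two faces `X, Y ≠ F` are linked in `ξ ∖ {b'}` iff they are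
linked in `ξ` (a path through the valence-one tip would have to enter and leave through `b'`). [cite: KhristoforovSmirnov2021, §1.2 (arXiv v1 p. 2: `IP(ξ)` is a union of disjoint paths)] -/
theorem TipFace.reachable_erase_iff {ξ : Finset (Sym2 (Site 2))} (hξ : ξ ⊆ (hBonds D).erase (side v i)) {X Y : HexVertex}
    (hX : X ≠ oppFace v i) (hY : Y ≠ oppFace v i) :
    (sideGraph (ξ.erase (side v' i'))).Reachable X Y ↔ (sideGraph ξ).Reachable X Y := by
  constructor
  · exact fun h => h.mono (sideGraph_erase_le' ξ _)
  · rintro ⟨p⟩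
    exact reachable_erase_of_walk T hξ hY p.length p le_rfl hX

/-- ★ **THE TOGGLE PRESERVES THE LINK RELATION**: for `ξ ∈ W_b(F)`, `linkRel D (ξ ∖ {b'}) = linkRel D ξ` (corner faces are not the tip).
[cite: KhristoforovSmirnov2021, §1.2 (arXiv v1 p. 2: the link pattern `IP(ξ)`)] -/
theorem TipFace.linkRel_erase {ξ : Finset (Sym2 (Site 2))} (hξ : ξ ∈ TXb D v i (oppFace v i)) :
    linkRel D (ξ.erase (side v' i')) = linkRel D ξ := by
  have hsub := ((mem_TXb_iff (D := D) v i (oppFace v i) ξ).1 hξ).1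
  ext ⟨a, c⟩
  rw [mem_linkRel, mem_linkRel, xiLinked_iff_reachable, xiLinked_iff_reachable,
    T.reachable_erase_iff hsub (T.yc_ne_oppFace a) (T.yc_ne_oppFace c)]

open Classical in
/-- ★★ **THE TOGGLE IS A PATTERN-PRESERVING BIJECTION `W_b(F) ≅ W_{b'}(v')`**: for every corner index `j` and every relation `L`, the configurations at `b` with odd face `F`
linked to `u_j` and link relation `L` are equinumerous with the configurations at `b'` with odd face `v'` linked to `u_j` and link relation `L` (`card_filter_inClassX_tip_eq` plus
`linkRel_erase`). [cite: KhristoforovSmirnov2021, §1.2 (arXiv v1 p. 2) and §2 Definition 3 (p. 4)] -/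
theorem TipFace.card_filter_pattern_tip_eq (j : Fin nm) (L : Finset (Fin nm × Fin nm)) :
    #((TXb D v i (oppFace v i)).filter fun ξ =>
        InClassX D (faceVertex v (i + 1)) (faceVertex v (i + 2)) (oppFace v i) j ξ ∧ linkRel D ξ = L) =
      #((TXb D v' i' v').filter fun η => InClassX D (faceVertex v' (i' + 1)) (faceVertex v' (i' + 2)) v' j η ∧ linkRel D η = L) := by
  classical
  refine Finset.card_bij (fun ξ _ => ξ.erase (side v' i')) (fun ξ hξ => ?_) (fun ξ₁ h₁ ξ₂ h₂ h => ?_) (fun η hη => ?_)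
  · rw [Finset.mem_filter] at hξ ⊢
    obtain ⟨hmem, hcl, hL⟩ := hξ
    rw [hbK_inClassX_iff] at hcl ⊢
    exact ⟨erase_mem_TXb T hmem, ⟨erase_mem_TXb T hmem, reachable_erase T hmem (T.yc_ne_oppFace j) hcl.2⟩,
      by rw [T.linkRel_erase hmem]; exact hL⟩
  · have hb1 := side'_mem_of_mem_TXb T (Finset.mem_filter.1 h₁).1
    have hb2 := side'_mem_of_mem_TXb T (Finset.mem_filter.1 h₂).1
    rw [← Finset.insert_erase hb1, ← Finset.insert_erase hb2, h]
  · rw [Finset.mem_filter] at hη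
    obtain ⟨hmem, hcl, hL⟩ := hη
    have hb : side v i ∉ η := side_not_mem_of_mem_TXb' T hmem
    have hb' : side v' i' ∉ η := fun h => (Finset.mem_erase.1 (((mem_TXb_iff (D := D) v' i' v' η).1 hmem).1 h)).1 rfl
    have hmem' : insert (side v' i') η ∈ TXb D v i (oppFace v i) := (insert_mem_TXb_iff T hb' hb).2 hmem
    refine ⟨insert (side v' i') η, ?_, Finset.erase_insert hb'⟩
    rw [Finset.mem_filter, hbK_inClassX_iff]
    rw [hbK_inClassX_iff] at hcl
    refine ⟨hmem', ⟨hmem', ?_⟩, ?_⟩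
    · exact reachable_of_erase T (Finset.mem_insert_self _ _) (by rw [Finset.erase_insert hb']; exact hcl.2)
    · rw [← T.linkRel_erase hmem', Finset.erase_insert hb']
      exact hL

open Classical in
/-- ★★★ **THE SITE LAW FOR THE PATTERN COUNTS (every number of marks).** For the two `H_G`-edges `b = side v i`, `b' = side v' i'` around a tip, the number `N_p` of loop
configurations with disorders at the corners and at the mid-edge — both halves of the subdivided edge — whose (partner, link relation) is the pattern `p` is the SAME at `b` and at
`b'`, for every pattern `p`. [cite: KhristoforovSmirnov2021, §1.2 (the law of the link pattern; arXiv v1 p. 2), §2 Definition 3 (p. 4) and Remark 6 (p. 5)] -/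
theorem TipFace.patternCount_eq (p : Pat nm) : patternCount D v i p = patternCount D v' i' p := by
  unfold patternCount
  rw [T.card_filter_pattern_tip_eq p.1.1 p.1.2, add_comm]
  congr 1
  exact (T.symm.card_filter_pattern_tip_eq p.1.1 p.1.2).symm

end TipPattern

/-! ### `N_p` is a function of the mid-edge -/

section EdgeSymmetry

variable {nm : ℕ} (D : TriMarkedDomain nm)

open Classical in
/-- the pattern counts are symmetric in the two endpoints of the bond (one half). [cite: KhristoforovSmirnov2021, §1.2 (arXiv v1 p. 2)] -/
theorem card_filter_pattern_comm (u w : Site 2) (s : HexVertex) (j : Fin nm) (L : Finset (Fin nm × Fin nm)) :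
    #((loopSpaceX D u w s).filter fun ξ => InClassX D u w s j ξ ∧ linkRel D ξ = L) =
      #((loopSpaceX D w u s).filter fun ξ => InClassX D w u s j ξ ∧ linkRel D ξ = L) := by
  rw [loopSpaceX_comm D u w s]
  congr 1
  exact Finset.filter_congr fun ξ _ => and_congr (inClassX_comm D u w s j ξ) Iff.rfl

open Classical in
/-- ★ **`N_p(z)` is a function of the mid-edge**: counted from either face of the edge it is the same number. [cite: KhristoforovSmirnov2021, §1.2 (arXiv v1 p. 2)] -/
theorem patternCount_oppFace_oppIdx (v : HexVertex) (i : Fin 3) (p : Pat nm) :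
    patternCount D (oppFace v i) (oppIdx v i) p = patternCount D v i p := by
  unfold patternCount TXb
  rw [faceVertex_oppFace_succ, faceVertex_oppFace_succ_succ, oppFace_oppFace, add_comm,
    card_filter_pattern_comm D (faceVertex v (i + 2)) (faceVertex v (i + 1)) v p.1.1 p.1.2,
    card_filter_pattern_comm D (faceVertex v (i + 2)) (faceVertex v (i + 1)) (oppFace v i) p.1.1 p.1.2]

end EdgeSymmetry

/-! ### The site law for `N_p` along the boundary: darts, stretches, runs -/

section Boundary

variable {nm : ℕ} {D : TriMarkedDomain nm}

/-- ★ **the site law for `N_p` at two consecutive boundary darts** `(u, v)`, `(u, w)` (`w = triLeftApex u v ∉ G`, the turning face not a corner): `N_p` read at the face right of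
`u → v` across `uv` equals `N_p` read at the face left of `u → w` across `uw`. [cite: KhristoforovSmirnov2021, §2 Remark 6 (arXiv v1 p. 5); BollobasRiordan2006, Ch. 7 §7.2.2 pp. 191–195] -/
theorem patternCount_site_law_darts {u v : Site 2} (hu : u ∈ D.verts) (hv : v ∉ D.verts) (hadj : triGraph.Adj u v)
    (hw : triLeftApex u v ∉ D.verts) (hF : leftFace u v ∉ corners D) (p : Pat nm) :
    ∃ i i' : Fin 3, side (leftFace v u) i = s(u, v) ∧ side (leftFace u (triLeftApex u v)) i' = s(u, triLeftApex u v) ∧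
      patternCount D (leftFace v u) i p = patternCount D (leftFace u (triLeftApex u v)) i' p := by
  obtain ⟨i, i', hi, hi', -, T⟩ := exists_tipFace_of_apex_not_mem hu hv hadj hw hF
  exact ⟨i, i', hi, hi', T.patternCount_eq p⟩

/-- ★★ **THE SITE LAW FOR `N_p` ALONG A STRETCH (`k ≥ 2`)**: for two consecutive boundary darts `(u, v)`, `(u, w)` of the same stretch `A_a` (`w = triLeftApex u v`), the pattern
counts at the dual `H_G`-edges `uv`, `uw` agree for every pattern. [cite: KhristoforovSmirnov2021, §2 Remark 6 (arXiv v1 p. 5); BollobasRiordan2006, Ch. 7 §7.2.2 pp. 191–195] -/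
theorem patternCount_site_law_stretch (h2 : 2 ≤ nm) {a : Fin nm} {u v : Site 2} (hd : (u, v) ∈ D.stretch a)
    (hd' : (u, triLeftApex u v) ∈ D.stretch a) (p : Pat nm) :
    ∃ i i' : Fin 3, side (leftFace v u) i = s(u, v) ∧ side (leftFace u (triLeftApex u v)) i' = s(u, triLeftApex u v) ∧
      patternCount D (leftFace v u) i p = patternCount D (leftFace u (triLeftApex u v)) i' p := by
  obtain ⟨-, -, -, -, hbd⟩ := pos_facts_of_mem_stretch hd
  obtain ⟨-, -, -, -, hbd'⟩ := pos_facts_of_mem_stretch hd'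
  obtain ⟨hu, hv, hadj⟩ := mem_triBdryDarts.1 hbd
  obtain ⟨-, hw, -⟩ := mem_triBdryDarts.1 hbd'
  exact patternCount_site_law_darts hu hv hadj hw (leftFace_not_mem_corners_of_mem_stretch h2 hd hd') p

/-- Auxiliary: the face across the side `uv` of `x` is the other touching face incident to `uv`. [cite: KhristoforovSmirnov2021, §1.2 (arXiv v1 p. 2)] -/
private theorem oppFace_eq_of_inc_pat {x G' : HexVertex} {j : Fin 3} {u v : Site 2} (hu : u ∈ D.verts) (hadj : triGraph.Adj u v)
    (hx : side x j = s(u, v)) (hG' : G' ∈ triFacesTouching D.verts) (hinc : Inc G' s(u, v)) (hne : G' ≠ x) : oppFace x j = G' := by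
  have hb : s(u, v) ∈ hBonds D := mem_hBonds D hadj (Or.inl hu)
  have hxt : x ∈ triFacesTouching D.verts := mem_touching_of_side_mem D (j := j) (by rw [hx]; exact hb)
  have hot : oppFace x j ∈ triFacesTouching D.verts :=
    mem_touching_of_side_mem D (j := oppIdx x j) (by rw [side_oppFace_oppIdx, hx]; exact hb)
  have ix : Inc x s(u, v) := by rw [← hx]; exact inc_side x j
  have io : Inc (oppFace x j) s(u, v) := by rw [← hx, ← side_oppFace_oppIdx x j]; exact inc_side _ _
  rcases eq_or_eq_of_inc_three D hb hxt hot hG' ix io hinc (hexGraph_adj_oppFace x j).ne with e | e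
  · exact absurd e hne
  · exact e.symm

/-- **the two readings of one `H_G`-edge**: `N_p` read at `leftFace u w` across `uw` equals `N_p` read at `leftFace w u` across `uw`.
[cite: KhristoforovSmirnov2021, §1.2 (arXiv v1 p. 2)] -/
theorem patternCount_leftFace_swap {u w : Site 2} (hu : u ∈ D.verts) (hadj : triGraph.Adj u w) {i₂ i₃ : Fin 3}
    (h₂ : side (leftFace u w) i₂ = s(u, w)) (h₃ : side (leftFace w u) i₃ = s(u, w)) (p : Pat nm) :
    patternCount D (leftFace u w) i₂ p = patternCount D (leftFace w u) i₃ p := by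
  have hb : s(u, w) ∈ hBonds D := mem_hBonds D hadj (Or.inl hu)
  have hx't : leftFace w u ∈ triFacesTouching D.verts := mem_touching_of_side_mem D (j := i₃) (by rw [h₃]; exact hb)
  have hinc : Inc (leftFace w u) s(u, w) := by rw [← h₃]; exact inc_side _ _
  have hne : leftFace w u ≠ leftFace u w := (leftFace_ne_leftFace_symm hadj).symm
  have hopp : oppFace (leftFace u w) i₂ = leftFace w u := oppFace_eq_of_inc_pat hu hadj h₂ hx't hinc hne
  have hidx : oppIdx (leftFace u w) i₂ = i₃ := by
    apply side_injective (leftFace w u)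
    rw [h₃]
    have := side_oppFace_oppIdx (leftFace u w) i₂
    rw [hopp] at this
    rw [this, h₂]
  rw [← patternCount_oppFace_oppIdx D (leftFace u w) i₂ p, hopp, hidx]

/-- ★★ **THE SITE LAW FOR `N_p` ALONG A RUN (`k ≥ 3`)**: two darts at positions `n ≤ n'` of the same stretch `A_a` with the same tail carry the same pattern count `N_p` at their dual
`H_G`-edges (read at the face right of the dart, at any side index presenting the bond) — **the law of the link pattern at a boundary mid-edge is a function of the boundary
hexagon.** [cite: KhristoforovSmirnov2021, §2 Remark 6 (arXiv v1 p. 5); BollobasRiordan2006, Ch. 7 §7.2.2 pp. 191–195] -/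
theorem patternCount_site_law_run (h3 : 3 ≤ nm) {a : Fin nm} {n n' : ℕ} (hn : D.pos a ≤ n) (hnn' : n ≤ n') (hn' : n' < D.nextPos a)
    (hfst : (triBdryIter D.verts D.base n').1 = (triBdryIter D.verts D.base n).1) (p : Pat nm) {i i' : Fin 3}
    (hi : side (leftFace (triBdryIter D.verts D.base n).2 (triBdryIter D.verts D.base n).1) i =
      s((triBdryIter D.verts D.base n).1, (triBdryIter D.verts D.base n).2))
    (hi' : side (leftFace (triBdryIter D.verts D.base n').2 (triBdryIter D.verts D.base n').1) i' =
      s((triBdryIter D.verts D.base n').1, (triBdryIter D.verts D.base n').2)) :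
    patternCount D (leftFace (triBdryIter D.verts D.base n).2 (triBdryIter D.verts D.base n).1) i p =
      patternCount D (leftFace (triBdryIter D.verts D.base n').2 (triBdryIter D.verts D.base n').1) i' p := by
  have h2 : 2 ≤ nm := by omega
  have hrun : ∀ m, n ≤ m → m ≤ n' → (triBdryIter D.verts D.base m).1 = (triBdryIter D.verts D.base n).1 := fun m hm1 hm2 =>
    fst_iter_eq_of_between h3 hn hnn' hn' rfl hfst hm1 hm2
  suffices H : ∀ m, n + m ≤ n' → ∀ i₁ : Fin 3,
      side (leftFace (triBdryIter D.verts D.base (n + m)).2 (triBdryIter D.verts D.base (n + m)).1) i₁ =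
        s((triBdryIter D.verts D.base (n + m)).1, (triBdryIter D.verts D.base (n + m)).2) →
      patternCount D (leftFace (triBdryIter D.verts D.base n).2 (triBdryIter D.verts D.base n).1) i p =
        patternCount D (leftFace (triBdryIter D.verts D.base (n + m)).2 (triBdryIter D.verts D.base (n + m)).1) i₁ p by
    have := H (n' - n) (by omega) i' (by rw [show n + (n' - n) = n' by omega]; exact hi')
    rw [show n + (n' - n) = n' by omega] at this
    exact this
  intro m
  induction m with
  | zero =>
    intro _ i₁ hi₁
    rw [Nat.add_zero] at hi₁ ⊢
    rw [side_injective _ (hi₁.trans hi.symm)]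
  | succ m ih =>
    intro hm i₁ hi₁
    rw [show n + (m + 1) = n + m + 1 from by omega] at hm hi₁ ⊢
    -- the darts `d = (u, v)` at `n + m` and `(u, w) = triBdrySucc d` at `n + m + 1`, `w = triLeftApex u v ∉ G`
    set d := triBdryIter D.verts D.base (n + m) with hd
    have hdm : d ∈ triBdryDarts D.verts := triBdryIter_mem D.base_mem _
    obtain ⟨hdG, -, hadj⟩ := mem_triBdryDarts.1 hdm
    have htail : d.1 = (triBdryIter D.verts D.base n).1 := hrun (n + m) (by omega) (by omega)
    have htail' : (triBdryIter D.verts D.base (n + m + 1)).1 = (triBdryIter D.verts D.base n).1 :=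
      hrun (n + m + 1) (by omega) (by omega)
    have hsucc : triBdryIter D.verts D.base (n + m + 1) = triBdrySucc D.verts d := triBdryIter_succ _ _ _
    have hout : triLeftApex d.1 d.2 ∉ D.verts := by
      intro h
      have e : (triBdryIter D.verts D.base (n + m + 1)).1 = triLeftApex d.1 d.2 := by
        rw [hsucc, triBdrySucc, if_pos h]
      exact (triLeftApex_ne hadj).1 (e.symm.trans (htail'.trans htail.symm))
    have e' : triBdryIter D.verts D.base (n + m + 1) = (d.1, triLeftApex d.1 d.2) := by
      rw [hsucc, triBdrySucc, if_neg hout]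
    have hdS : (d.1, d.2) ∈ D.stretch a :=
      Finset.mem_image.2 ⟨n + m, Finset.mem_Ico.2 ⟨by omega, by omega⟩, rfl⟩
    have hdS' : (d.1, triLeftApex d.1 d.2) ∈ D.stretch a := by
      rw [← e']
      exact Finset.mem_image.2 ⟨n + m + 1, Finset.mem_Ico.2 ⟨by omega, by omega⟩, rfl⟩
    obtain ⟨i₂, i₃, h₂', h₃', hstep⟩ := patternCount_site_law_stretch h2 hdS hdS' p
    rw [ih (by omega) i₂ h₂', hstep]
    rw [e'] at hi₁ ⊢
    exact patternCount_leftFace_swap hdG (triGraph_adj_triLeftApex_left hadj) h₃' hi₁ p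

end Boundary

/-! ### The boundary law is a function of the boundary hexagon -/

section Laws

/-- ★★★ **the count vectors of two boundary mid-edges of an arc forming a tip coincide.** [cite: KhristoforovSmirnov2021, §1.2 (arXiv v1 p. 2: the law of the link pattern); §2 Remark 6 (p. 5)] -/
theorem ArcPoint.vec_eq_of_tipFace {nm : ℕ} {D : TriMarkedDomain nm} {a : Fin nm} (z z' : ArcPoint D a) (T : TipFace D z.v z.i z'.v z'.i) :
    z.vec = z'.vec := by
  funext p
  rw [ArcPoint.vec_apply, ArcPoint.vec_apply, T.patternCount_eq p.1]

/-- ★★★ **THE BOUNDARY LINK-PATTERN LAW IS A FUNCTION OF THE BOUNDARY HEXAGON**: for two home-arc boundary mid-edges `z`, `z'` forming a tip (the two `H_G`-edges around one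
non-marked boundary hexagon), `lawLP z = lawLP z'` in the planar Temperley–Lieb module. [cite: KhristoforovSmirnov2021, §1.2 (arXiv v1 p. 2: the law of the link pattern); §2 Remark 6 (p. 5); PearceRittenbergDeGierNienhuis2002, §2] -/
theorem lawLP_eq_of_tipFace {n : ℕ} {D : TriMarkedDomain (n + 1)} (z z' : ArcPoint D (Fin.last n)) (T : TipFace D z.v z.i z'.v z'.i) :
    lawLP z = lawLP z' := by
  refine Finsupp.ext fun Q => ?_
  rw [lawLP_apply, lawLP_apply, T.patternCount_eq]

end Laws

end Literature.Probability.Percolation.MarkedLoops
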